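import Summits.ValiantsHypothesis.ValiantsHypothesis.Theorems.SuccinctLiftJointPD

/-!
# SuccinctLift — restriction of scalars along a power basis at the SAME product depth

Route `route-ValiantsHypothesis-SuccinctLift` (lens 2), wall D (`AlgDescentLog3`,
stmt-ValiantsHypothesis-23721): removing algebraic constants from a poly-wire product-depth-`Δ₁(n)`
circuit family.  Generation 28 recorded as a PAPER claim (NODE §2(iii)) that constants from a fixed
number field descend to `ℚ` at the same product depth; this file puts the uniform statement in the
kernel.

* `exists_circuit_coord` — let `k` be a field of characteristic `0` and `R` a commutative
  `k`-algebra with a power basis `1, θ, …, θ^{d-1}` (`pb : PowerBasis k R`).  Every circuit `C`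
  over `R` (unbounded fan-in) has, for each coordinate `c < d`, a circuit over `k` computing the
  `c`-th coordinate polynomial of `C.eval`, of product depth `≤ C.productDepth` and edge size
  `≤ 4 d² · C.edgeSize²`.  Sum gates are simulated by ONE linear layer (multiplication matrices); a
  product gate of fan-in `m` by evaluating the lifted factors (degree `< d` in `θ`) at the
  `L = m(d-1)+1` integer nodes `0, …, L-1` (linear), ONE layer of `L` product gates of fan-in `m`,
  and Vandermonde interpolation followed by reduction modulo the minimal polynomial (linear) — so
  the product depth does not grow, in contrast with the (depth-oblivious) structure-constant
  simulation of Hrubeš–Yehudayoff (tree: `CommExtSim.complexity_lmap_le`).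
* `exists_circuit_of_powerBasis` — hence a circuit over `R` computing `f ⊗ R`, `f ∈ k[x]`, yields a
  circuit over `k` computing `f` of the same product depth and edge size `≤ 4 d² s²`.

Route-independent (no `Theses` import); the dial corollaries for the permanent are in
`SuccinctLiftNumberFieldDescent.lean`.

References: Burgisser2000 (§4.1; Rem. 2.7); HrubesYehudayoff2011 (Thm 4.2);
LimayeSrinivasanTavenas2021 (§2); BurgisserClausenShokrollahi1997 ((4.15)).
-/

noncomputable section

open MvPolynomial

-- the summit and the problem share the name `ValiantsHypothesis` (D-0017 single-conjunct layout)
set_option linter.dupNamespace false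

namespace Summit.ValiantsHypothesis.ValiantsHypothesis.Theorems.SuccinctLiftPowerBasisDescent

open Literature.Computability.AlgebraicComplexity ArithCircuit
open Summit.ValiantsHypothesis.ValiantsHypothesis.Theorems.SuccinctLiftJointPD

universe u v w

/-! ### Interpolation: coordinates of a product through ONE product layer -/

section Interp

variable {F : Type u} [Field F] {A : Type*} [CommRing A] [Algebra F A]

/-- Vandermonde inversion for a polynomial of degree `< L` over an `F`-algebra: its coefficients
are the fixed `F`-linear combinations (rows of the inverse Vandermonde matrix) of its values at `L`
distinct nodes of `F`. [cite: Burgisser2000, Rem. 2.7] -/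
theorem coeff_eq_sum_vandermonde_inv {L : ℕ} (t : Fin L → F) (ht : Function.Injective t)
    (Q : Polynomial A) (hQ : Q.natDegree < L) (j : Fin L) :
    Q.coeff j = ∑ l, ((Matrix.vandermonde t)⁻¹ j l) • Q.eval (algebraMap F A (t l)) := by
  classical
  have hdet : IsUnit (Matrix.vandermonde t).det :=
    (Matrix.det_vandermonde_ne_zero_iff.2 ht).isUnit
  have hinv := Matrix.nonsing_inv_mul _ hdet
  have heval : ∀ l, Q.eval (algebraMap F A (t l)) = ∑ i : Fin L, (t l ^ (i : ℕ)) • Q.coeff i := by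
    intro l
    conv_lhs => rw [Q.as_sum_range' L hQ]
    rw [Polynomial.eval_finsetSum, Finset.sum_range]
    refine Finset.sum_congr rfl fun i _ => ?_
    rw [Polynomial.eval_monomial, Algebra.smul_def, map_pow, mul_comm]
  simp_rw [heval, Finset.smul_sum, smul_smul]
  rw [Finset.sum_comm]
  have hrow : ∀ i : Fin L, ∑ l, (Matrix.vandermonde t)⁻¹ j l * t l ^ (i : ℕ) =
      (1 : Matrix (Fin L) (Fin L) F) j i := by
    intro i
    rw [← hinv, Matrix.mul_apply]
    simp [Matrix.vandermonde_apply]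
  simp_rw [← Finset.sum_smul, hrow, Matrix.one_apply, ite_smul, one_smul, zero_smul,
    Finset.sum_ite_eq, Finset.mem_univ, if_true]

variable {R : Type v} [CommRing R] [Algebra F R] {σ : Type*}

/-- **Coordinates of a product, through one product layer.**  With a power basis `1, θ, …, θ^{d-1}`
of `R` over `F`, the `c`-th coordinate polynomial of `∏_{e<m} u_e` (`u_e ∈ R[X_σ]`) is the fixed
linear combination `∑_l w_{c,l} · ∏_e E_{e,l}` of the `L > m(d-1)` products of the LINEAR forms
`E_{e,l} = ∑_κ t_l^κ · (u_e)_κ` in the coordinates (evaluate the lifts at the nodes, multiply,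
interpolate, reduce modulo the minimal polynomial of `θ`). [cite: Burgisser2000, §4.1] -/
theorem coord_prod_eq (pb : PowerBasis F R) {m : ℕ} (u : Fin m → MvPolynomial σ R) (L : ℕ)
    (hL : m * (pb.dim - 1) < L) (t : Fin L → F) (ht : Function.Injective t) (c : Fin pb.dim) :
    CommExtSim.lmap (pb.basis.coord c) (∏ e, u e) =
      ∑ l, (∑ j : Fin L, pb.basis.repr (pb.gen ^ (j : ℕ)) c * (Matrix.vandermonde t)⁻¹ j l) •
        ∏ e, ∑ κ : Fin pb.dim, (t l ^ (κ : ℕ)) • CommExtSim.lmap (pb.basis.coord κ) (u e) := by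
  classical
  let Qe : Fin m → Polynomial (MvPolynomial σ F) := fun e =>
    ∑ κ : Fin pb.dim, Polynomial.monomial (κ : ℕ) (CommExtSim.lmap (pb.basis.coord κ) (u e))
  let Q : Polynomial (MvPolynomial σ F) := ∏ e, Qe e
  let ev : Polynomial (MvPolynomial σ F) →+* MvPolynomial σ R :=
    Polynomial.eval₂RingHom (MvPolynomial.map (algebraMap F R)) (C pb.gen)
  have hev : ∀ e, ev (Qe e) = u e := by
    intro e
    simp only [ev, Qe, Polynomial.coe_eval₂RingHom, Polynomial.eval₂_finsetSum,
      Polynomial.eval₂_monomial]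
    conv_rhs => rw [CommExtSim.eq_sum_C_mul_map_coord pb.basis (u e)]
    refine Finset.sum_congr rfl fun κ _ => ?_
    rw [pb.basis_eq_pow, C_pow, mul_comm]
  have hdeg : Q.natDegree < L := by
    refine lt_of_le_of_lt ((Polynomial.natDegree_prod_le _ _).trans ?_) hL
    have hQe : ∀ e, (Qe e).natDegree ≤ pb.dim - 1 := fun e =>
      Polynomial.natDegree_sum_le_of_forall_le _ _ fun κ _ =>
        (Polynomial.natDegree_monomial_le _).trans (by have := κ.isLt; omega)
    calc ∑ e, (Qe e).natDegree ≤ ∑ _e : Fin m, (pb.dim - 1) :=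
          Finset.sum_le_sum fun e _ => hQe e
      _ = m * (pb.dim - 1) := by simp
  have hprod : (∏ e, u e) = ev Q := by
    rw [map_prod]
    exact Finset.prod_congr rfl fun e _ => (hev e).symm
  have hQsum : ev Q = ∑ j : Fin L, C (pb.gen ^ (j : ℕ)) *
      MvPolynomial.map (algebraMap F R) (Q.coeff j) := by
    conv_lhs => rw [Q.as_sum_range' L hdeg]
    rw [map_sum, Finset.sum_range]
    refine Finset.sum_congr rfl fun j _ => ?_
    simp only [ev, Polynomial.coe_eval₂RingHom, Polynomial.eval₂_monomial]
    rw [C_pow, mul_comm]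
  have hevl : ∀ l, Q.eval (algebraMap F (MvPolynomial σ F) (t l)) =
      ∏ e, ∑ κ : Fin pb.dim, (t l ^ (κ : ℕ)) • CommExtSim.lmap (pb.basis.coord κ) (u e) := by
    intro l
    simp only [Q, Polynomial.eval_prod]
    refine Finset.prod_congr rfl fun e _ => ?_
    simp only [Qe, Polynomial.eval_finsetSum, Polynomial.eval_monomial]
    refine Finset.sum_congr rfl fun κ _ => ?_
    rw [Algebra.smul_def, map_pow, mul_comm]
  rw [hprod, hQsum, CommExtSim.lmap_sum]
  simp_rw [CommExtSim.lmap_C_mul_map, Module.Basis.coord_apply]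
  simp_rw [coeff_eq_sum_vandermonde_inv t ht Q hdeg, hevl, Finset.smul_sum, smul_smul]
  rw [Finset.sum_comm]
  simp_rw [← Finset.sum_smul]

end Interp

/-! ### The gate-local simulation -/

section Simulation

variable {F : Type u} [Field F] {R : Type v} [CommRing R] [Algebra F R] {σ : Type w}

/-- The family simulated at a stage with value list `vals` and depth list `ds` over `R`: ALL
coordinates of ALL operands (variables, constants, gate references — out-of-range ones read the
junk value `0`, as in the semantics). [cite: Burgisser2000, Def. 2.1] -/
def coordFamily (pb : PowerBasis F R) (vals : List (MvPolynomial σ R)) :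
    Operand R σ × Fin pb.dim → MvPolynomial σ F :=
  fun p => CommExtSim.lmap (pb.basis.coord p.2) (p.1.eval vals)

/-- `coordFamily` unfolded. [cite: Burgisser2000, Def. 2.1] -/
@[simp] theorem coordFamily_apply (pb : PowerBasis F R) (vals : List (MvPolynomial σ R))
    (o : Operand R σ) (c : Fin pb.dim) :
    coordFamily pb vals (o, c) = CommExtSim.lmap (pb.basis.coord c) (o.eval vals) := rfl

/-- Coordinates of `1` along a power basis: `δ_{c,0}`. [folklore] -/
theorem repr_one_eq (pb : PowerBasis F R) (c : Fin pb.dim) :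
    pb.basis.repr 1 c = if (c : ℕ) = 0 then 1 else 0 := by
  have h0 : 0 < pb.dim := c.pos
  have h1 : (1 : R) = pb.basis ⟨0, h0⟩ := by rw [pb.basis_eq_pow]; simp
  rw [h1, pb.basis.repr_self, Finsupp.single_apply]
  by_cases hc : (c : ℕ) = 0
  · have : (⟨0, h0⟩ : Fin pb.dim) = c := Fin.ext (by simp [hc])
    simp [this, hc]
  · have : (⟨0, h0⟩ : Fin pb.dim) ≠ c := fun h => hc (by rw [← h])
    simp [this, hc]

/-- The coordinates of a variable or a constant operand are variables or constants.
[cite: Burgisser2000, Def. 2.1] -/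
theorem coordFamily_input (pb : PowerBasis F R) (vals : List (MvPolynomial σ R))
    (o : Operand R σ) (c : Fin pb.dim) (ho : ∀ j, o ≠ Operand.gate j) :
    (∃ x, coordFamily pb vals (o, c) = X x) ∨ ∃ a, coordFamily pb vals (o, c) = C a := by
  cases o with
  | var x =>
    rw [coordFamily_apply, Operand.eval, CommExtSim.lmap_coord_X, repr_one_eq]
    by_cases hc : (c : ℕ) = 0
    · exact Or.inl ⟨x, by rw [if_pos hc, one_smul]⟩
    · exact Or.inr ⟨0, by rw [if_neg hc, zero_smul, C_0]⟩
  | const r =>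
    rw [coordFamily_apply, Operand.eval, CommExtSim.lmap_coord_C]
    exact Or.inr ⟨_, rfl⟩
  | gate j => exact absurd rfl (ho j)

/-- **Sum gadget**: the coordinates of a sum gate are ONE linear layer over the coordinates of its
operands (matrices of multiplication by the coefficients), `d² · fan-in` wires, no product depth.
[cite: HrubesYehudayoff2011, Thm 4.2] -/
theorem gadget_sum (pb : PowerBasis F R) (vals : List (MvPolynomial σ R)) (ds : List ℕ) {s : ℕ}
    (h : JointPD (coordFamily pb vals) (fun p => p.1.depthIn ds) s)
    (args : List (R × Operand R σ)) :
    JointPD (Sum.elim (coordFamily pb vals)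
        (fun c : Fin pb.dim => CommExtSim.lmap (pb.basis.coord c) ((Gate.sum args).eval vals)))
      (Sum.elim (fun p => p.1.depthIn ds)
        (fun _ => prodWeight (Gate.sum args) + ((Gate.sum args).args.map (Operand.depthIn ds)).foldr max 0))
      (s + 4 * pb.dim ^ 2 * args.length ^ 2) := by
  classical
  set D := ((Gate.sum args).args.map (Operand.depthIn ds)).foldr max 0 with hDdef
  have h1 := h.extend_sum (κ := Fin pb.dim) (J := Fin args.length × Fin pb.dim)
    (fun c ej => pb.basis.repr ((args[(ej.1 : ℕ)]).1 * pb.basis ej.2) c)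
    (fun _ ej => ((args[(ej.1 : ℕ)]).2, ej.2)) D (by
      intro c ej
      refine le_foldr_max_of_mem ?_
      simp only [Gate.args, List.map_map, List.mem_map, Function.comp_apply]
      exact ⟨args[(ej.1 : ℕ)], List.getElem_mem _, rfl⟩)
  refine h1.reindex _ _ ?_ ?_
  · simp only [Fintype.card_prod, Fintype.card_fin]
    rcases Nat.eq_zero_or_pos args.length with hm | hm
    · rw [hm]; simp
    · have : pb.dim * (args.length * pb.dim) ≤ 4 * pb.dim ^ 2 * args.length ^ 2 :=
        calc pb.dim * (args.length * pb.dim) = pb.dim ^ 2 * args.length * 1 := by ring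
          _ ≤ pb.dim ^ 2 * args.length * (4 * args.length) := Nat.mul_le_mul_left _ (by omega)
          _ = 4 * pb.dim ^ 2 * args.length ^ 2 := by ring
      omega
  · rintro (p | c)
    · exact Or.inl ⟨Sum.inl p, rfl, le_rfl⟩
    · refine Or.inl ⟨Sum.inr c, ?_, by simp⟩
      simp only [Sum.elim_inr, coordFamily_apply, Gate.eval]
      rw [← List.ofFn_getElem_eq_map args (fun a => a.1 • a.2.eval vals), List.sum_ofFn,
        CommExtSim.lmap_sum]
      simp_rw [CommExtSim.lmap_coord_smul pb.basis]
      rw [Fintype.sum_prod_type]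

/-- **Product gadget**: the coordinates of a product gate of fan-in `m` are obtained from the
coordinates of its operands by a linear layer (evaluation of the lifted factors at `m(d-1)+1`
integer nodes), ONE product layer, and a linear layer (interpolation + reduction): `≤ 4 d² m²`
wires, product depth `+1` — exactly the weight of the simulated gate. [cite: Burgisser2000, §4.1] -/
theorem gadget_prod [CharZero F] (pb : PowerBasis F R) (vals : List (MvPolynomial σ R)) (ds : List ℕ) {s : ℕ}
    (h : JointPD (coordFamily pb vals) (fun p => p.1.depthIn ds) s)
    (args : List (Operand R σ)) :
    JointPD (Sum.elim (coordFamily pb vals)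
        (fun c : Fin pb.dim => CommExtSim.lmap (pb.basis.coord c) ((Gate.prod args).eval vals)))
      (Sum.elim (fun p => p.1.depthIn ds)
        (fun _ => prodWeight (Gate.prod args) +
          ((Gate.prod args).args.map (Operand.depthIn ds)).foldr max 0))
      (s + 4 * pb.dim ^ 2 * args.length ^ 2) := by
  classical
  set D := ((Gate.prod args).args.map (Operand.depthIn ds)).foldr max 0 with hDdef
  -- empty product: the coordinates of `1` are constants
  rcases Nat.eq_zero_or_pos args.length with hm | hm
  · have hnil : args = [] := List.length_eq_zero_iff.1 hm
    refine h.reindex _ _ (by simp) ?_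
    rintro (p | c)
    · exact Or.inl ⟨p, rfl, le_rfl⟩
    · refine Or.inr (Or.inr ⟨pb.basis.repr 1 c, ?_⟩)
      simp only [Sum.elim_inr, hnil, Gate.eval, List.map_nil, List.prod_nil]
      exact CommExtSim.lmap_coord_one pb.basis c
  -- no coordinates: nothing to compute
  rcases Nat.eq_zero_or_pos pb.dim with hd | hd
  · refine h.reindex _ _ (by simp) ?_
    rintro (p | c)
    · exact Or.inl ⟨p, rfl, le_rfl⟩
    · exact absurd c.isLt (by omega)
  -- the three layers
  set m := args.length with hmdef
  set L := m * (pb.dim - 1) + 1 with hLdef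
  let t : Fin L → F := fun l => ((l : ℕ) : F)
  have ht : Function.Injective t := fun l l' hl => Fin.ext ((Nat.cast_injective (R := F)) hl)
  have h1 := h.extend_sum (κ := Fin m × Fin L) (J := Fin pb.dim)
    (fun el κ => t el.2 ^ (κ : ℕ)) (fun el κ => (args[(el.1 : ℕ)], κ)) D (by
      intro el κ
      refine le_foldr_max_of_mem ?_
      simp only [Gate.args, List.mem_map]
      exact ⟨args[(el.1 : ℕ)], List.getElem_mem _, rfl⟩)
  have h2 := h1.extend_prod (κ := Fin L) (J := Fin m) (fun l e => Sum.inr (e, l)) D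
    (fun _ _ => le_rfl)
  have h3 := h2.extend_sum (κ := Fin pb.dim) (J := Fin L)
    (fun c l => ∑ j : Fin L, pb.basis.repr (pb.gen ^ (j : ℕ)) c * (Matrix.vandermonde t)⁻¹ j l)
    (fun _ l => Sum.inr l) (D + 1) (fun _ _ => le_rfl)
  refine h3.reindex _ _ ?_ ?_
  · -- wires: m·L·d + L·m + d·L ≤ 4 d² m²
    simp only [Fintype.card_prod, Fintype.card_fin]
    have hL' : L ≤ m * pb.dim := by
      rw [hLdef]
      obtain ⟨d', hd'⟩ : ∃ d', pb.dim = d' + 1 := ⟨pb.dim - 1, by omega⟩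
      rw [hd', Nat.add_sub_cancel]
      nlinarith
    have key : m * L * pb.dim + L * m + pb.dim * L ≤ 4 * pb.dim ^ 2 * m ^ 2 := by
      have h3' : m * pb.dim + m + pb.dim ≤ 3 * (m * pb.dim) := by nlinarith
      calc m * L * pb.dim + L * m + pb.dim * L = L * (m * pb.dim + m + pb.dim) := by ring
        _ ≤ (m * pb.dim) * (3 * (m * pb.dim)) := Nat.mul_le_mul hL' h3'
        _ = 3 * (pb.dim ^ 2 * m ^ 2) := by ring
        _ ≤ 4 * pb.dim ^ 2 * m ^ 2 := by nlinarith
    omega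
  · rintro (p | c)
    · exact Or.inl ⟨Sum.inl (Sum.inl (Sum.inl p)), rfl, le_rfl⟩
    · refine Or.inl ⟨Sum.inr c, ?_, by simp [prodWeight_prod, add_comm]⟩
      simp only [Sum.elim_inr, coordFamily_apply, Gate.eval]
      rw [← List.ofFn_getElem_eq_map args (fun u => u.eval vals), List.prod_ofFn,
        coord_prod_eq pb (fun e : Fin m => (args[(e : ℕ)]).eval vals) L (Nat.lt_succ_self _) t ht c]

/-- **The simulation invariant**: after any prefix `gs` of gates over `R`, all coordinates of all
operands are jointly computed over `F` with, per operand, product depth at most its product depth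
over `R`, within `4 d² · (total fan-in)²` wires. [cite: Burgisser2000, §4.1] -/
theorem jointPD_coordFamily [CharZero F] (pb : PowerBasis F R) (gs : List (Gate R σ)) :
    JointPD (coordFamily pb (gateValues gs)) (fun p => p.1.depthIn (gateWDepths prodWeight gs))
      (4 * pb.dim ^ 2 * ((gs.map Gate.fanIn).sum) ^ 2) := by
  classical
  induction gs using List.reverseRecOn with
  | nil =>
    refine jointPD_of_inputs _ _ _ fun p => ?_
    obtain ⟨o, c⟩ := p
    cases o with
    | gate j =>
      refine Or.inr ⟨0, ?_⟩
      simp [coordFamily_apply, Operand.eval, gateValues]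
    | var x => exact coordFamily_input pb _ _ c (fun j h => by cases h)
    | const r => exact coordFamily_input pb _ _ c (fun j h => by cases h)
  | append_singleton gs g ih =>
    have hg : JointPD (Sum.elim (coordFamily pb (gateValues gs))
        (fun c : Fin pb.dim => CommExtSim.lmap (pb.basis.coord c) (g.eval (gateValues gs))))
      (Sum.elim (fun p => p.1.depthIn (gateWDepths prodWeight gs))
        (fun _ => prodWeight g + (g.args.map (Operand.depthIn (gateWDepths prodWeight gs))).foldr max 0))
      (4 * pb.dim ^ 2 * ((gs.map Gate.fanIn).sum) ^ 2 + 4 * pb.dim ^ 2 * g.fanIn ^ 2) := by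
      cases g with
      | sum args =>
        have := gadget_sum pb (gateValues gs) (gateWDepths prodWeight gs) ih args
        simpa [Gate.fanIn, Gate.args] using this
      | prod args =>
        have := gadget_prod pb (gateValues gs) (gateWDepths prodWeight gs) ih args
        simpa [Gate.fanIn, Gate.args] using this
    refine hg.reindex _ _ ?_ ?_
    · rw [List.map_append, List.sum_append, List.map_singleton, List.sum_singleton]
      have hsq : (gs.map Gate.fanIn).sum ^ 2 + g.fanIn ^ 2 ≤
          ((gs.map Gate.fanIn).sum + g.fanIn) ^ 2 := by
        calc (gs.map Gate.fanIn).sum ^ 2 + g.fanIn ^ 2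
            ≤ (gs.map Gate.fanIn).sum ^ 2 + g.fanIn ^ 2 + 2 * (gs.map Gate.fanIn).sum * g.fanIn :=
              Nat.le_add_right _ _
          _ = ((gs.map Gate.fanIn).sum + g.fanIn) ^ 2 := by ring
      calc 4 * pb.dim ^ 2 * (gs.map Gate.fanIn).sum ^ 2 + 4 * pb.dim ^ 2 * g.fanIn ^ 2
          = 4 * pb.dim ^ 2 * ((gs.map Gate.fanIn).sum ^ 2 + g.fanIn ^ 2) := by ring
        _ ≤ 4 * pb.dim ^ 2 * ((gs.map Gate.fanIn).sum + g.fanIn) ^ 2 := Nat.mul_le_mul_left _ hsq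
    · rintro ⟨o, c⟩
      cases o with
      | var x => exact Or.inr (coordFamily_input pb _ _ c (fun j h => by cases h))
      | const r => exact Or.inr (coordFamily_input pb _ _ c (fun j h => by cases h))
      | gate j =>
        rcases Nat.lt_trichotomy j gs.length with hj | hj | hj
        · refine Or.inl ⟨Sum.inl (Operand.gate j, c), ?_, ?_⟩
          · simp only [coordFamily_apply, Sum.elim_inl, Operand.eval, gateValues_append_singleton]
            rw [List.getD_append _ _ _ _ (by simpa using hj)]
          · simp only [Sum.elim_inl, Operand.depthIn, gateWDepths_append_singleton]
            rw [List.getD_append _ _ _ _ (by simpa [gateWDepths_length] using hj)]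
        · subst hj
          refine Or.inl ⟨Sum.inr c, ?_, ?_⟩
          · simp only [coordFamily_apply, Sum.elim_inr, Operand.eval, gateValues_append_singleton]
            rw [List.getD_append_right _ _ _ _ (by simp), gateValues_length, Nat.sub_self]
            rfl
          · simp only [Sum.elim_inr, Operand.depthIn, gateWDepths_append_singleton]
            rw [List.getD_append_right _ _ _ _ (by simp [gateWDepths_length]), gateWDepths_length,
              Nat.sub_self]
            simp
        · refine Or.inr (Or.inr ⟨0, ?_⟩)
          simp only [coordFamily_apply, Operand.eval, gateValues_append_singleton]
          rw [List.getD_append_right _ _ _ _ (by simp; omega), gateValues_length,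
            List.getD_eq_getElem?_getD, List.getElem?_singleton]
          have : j - gs.length ≠ 0 := by omega
          simp [this]

/-- **Restriction of scalars at fixed product depth (unbounded fan-in).**  For a field `F` of
characteristic `0` and a commutative `F`-algebra `R` with a power basis of dimension `d`, every
circuit over `R` has, for every coordinate `c < d`, a circuit over `F` computing the `c`-th coordinate
polynomial of its value, of product depth `≤` its product depth and edge size `≤ 4 d² · edgeSize²`.
[cite: Burgisser2000, §4.1] -/
theorem exists_circuit_coord [CharZero F] (pb : PowerBasis F R) (C : ArithCircuit R σ) (c : Fin pb.dim) :
    ∃ C' : ArithCircuit F σ, C'.Computes (CommExtSim.lmap (pb.basis.coord c) C.eval) ∧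
      C'.productDepth ≤ C.productDepth ∧ C'.edgeSize ≤ 4 * pb.dim ^ 2 * C.edgeSize ^ 2 :=
  (jointPD_coordFamily pb C.gates).toCircuit (C.output, c)

/-- **Number-field-type constants are free at fixed product depth, up to `4 d² s²` wires.**  If a
circuit over `R` (power basis of dimension `d` over `F`, `char F = 0`) computes `f ⊗ R` for
`f ∈ F[X_σ]`, then some circuit over `F` computes `f` with product depth `≤` and edge size
`≤ 4 d² · edgeSize²`. [cite: Burgisser2000, §4.1] -/
theorem exists_circuit_of_powerBasis [CharZero F] [Nontrivial R] (pb : PowerBasis F R) (C : ArithCircuit R σ)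
    (f : MvPolynomial σ F) (hC : C.Computes (MvPolynomial.map (algebraMap F R) f)) :
    ∃ C' : ArithCircuit F σ, C'.Computes f ∧ C'.productDepth ≤ C.productDepth ∧
      C'.edgeSize ≤ 4 * pb.dim ^ 2 * C.edgeSize ^ 2 := by
  let c₀ : Fin pb.dim := ⟨0, pb.dim_pos⟩
  obtain ⟨C', h1, h2, h3⟩ := exists_circuit_coord pb C c₀
  refine ⟨C', ?_, h2, h3⟩
  rw [ArithCircuit.Computes] at h1 ⊢
  rw [h1, hC]
  have : MvPolynomial.map (algebraMap F R) f = MvPolynomial.C 1 * MvPolynomial.map (algebraMap F R) f :=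
    by rw [C_1, one_mul]
  rw [this, CommExtSim.lmap_C_mul_map, Module.Basis.coord_apply, repr_one_eq, if_pos rfl, one_smul]

end Simulation

end Summit.ValiantsHypothesis.ValiantsHypothesis.Theorems.SuccinctLiftPowerBasisDescent
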